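import Mathlib
import Summits.Ventures.HodgeRepro.Tier4.Line1.RTFSetting
import Summits.Ventures.HodgeRepro.Tier4.Line1.RtfUnfold
import Summits.Ventures.HodgeRepro.Tier4.Line1.KernelSupportFinite
import Summits.Ventures.HodgeRepro.Tier4.Line1.KernelUnfold
import Summits.Ventures.HodgeRepro.Tier4.Line1.KernelOperator
import Summits.Ventures.HodgeRepro.Tier4.Line1.KernelOpEqR

/-!
# Tier4/Line1/InnerCalculus — LINE L1, towards J1-(4b): rigidity, unitarity and the adjoint for `S.inner`

Blind re-derivation cell `pub-hodge-repro`, Tier 4 «prove the step» (README §9–§10), seat t4-L1-p4 (prover, gen 0;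
after L1.2b `rtf_spectral` p665818 the seat took J1-(4b) `exists_irreducible_invariant_subspace` (Skeleton v0.16 L444,
the declared wall) as census + rungs, S12549).  Generic Part I, over every `RTF.Setting G`; imports the landed
kernel-operator layer of t4-L1-p1 / t4-L1-p3 by name (`kernel_continuous`, `kernelOp`, `kernelOp_eq_R`).

The rungs here are the calculus of the ad hoc `L²(DG)` inner product `S.inner` on CONTINUOUS `G(k)`-INVARIANT
functions — the vocabulary in which (4b) is stated, so that the Deitmar–Echterhoff minimality argument
(9.2.7) can be run without building the unitary `G`-action on `L²(DG)`:
* R-0 `countable_Gk`: `[SecondCountableTopology G]` makes the discrete closed `G(k)` countable.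
* R-A `eq_of_ae_eq_DG` (`[Countable Gk]`): continuous invariant functions equal a.e. on `DG` are equal — the open
  invariant set where they differ meets `DG` in positive measure (`measure_inter_DG_pos_of_invariant`:
  `ae_covers` + countable subadditivity + left invariance + `IsOpenPosMeasure`); `eq_zero_of_inner_self_eq_zero`.
* R-B `inner_rightTranslate`: right translation is unitary for `S.inner` on invariant functions — `DG · g` is a
  fundamental domain (`isFundamentalDomain_mul_right`, `image_of_equiv` + `rightInv`) and
  `IsFundamentalDomain.setIntegral_eq` moves the integral of an invariant function between fundamental domains.
* `kernel_refl` (`K_{fˇ}(x, w) = K_f(w, x)`), `kernel_cj` (`K_{conj f} = conj K_f`).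
* R-C `inner_R_eq_inner_R_adj` (`[SecondCountableTopology G]`): `⟨R(f)ψ, φ⟩ = ⟨ψ, R(f*)φ⟩` with `f* = conj fˇ`, by the
  kernel forms of both sides and Fubini on `DG × DG` (`ae_prod_mem_DG`, `integrable_prod_DG`).
Every statement is `∀` over the defined `Setting`; nothing is assumed.

Nothing here says anything about the status of the Hodge conjecture for CM abelian varieties, which is NOT proved;
HC_CM is NOT proved by anyone in this repository.
-/

set_option autoImplicit false

noncomputable section

namespace Summit.Ventures.HodgeRepro.Tier4.Line1

open MeasureTheory Topology Filter Set
open scoped Uniformity Pointwise ComplexConjugate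

namespace RTF

variable {G : Type} [Group G] [TopologicalSpace G] [IsTopologicalGroup G] [MeasurableSpace G]
  [BorelSpace G]

namespace Setting

variable (S : Setting G)


omit [IsTopologicalGroup G] [BorelSpace G] in
/-- R-0: in a second countable `G` the discrete closed subgroup `G(k)` is countable (a discrete Lindelöf
space is countable). -/
theorem countable_Gk [SecondCountableTopology G] : Countable S.Gk := by
  haveI : DiscreteTopology S.Gk := S.discrete
  haveI : SecondCountableTopology S.Gk := inferInstance
  exact countable_of_Lindelof_of_discrete

/-- an invariant open set of positive measure meets `DG` in positive measure (`[Countable Gk]`). -/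
theorem measure_inter_DG_pos_of_invariant [Countable S.Gk] {U : Set G} (hU : IsOpen U)
    (hne : U.Nonempty) (hinv : ∀ γ : S.Gk, ∀ x, x ∈ U ↔ (γ : G) * x ∈ U) :
    0 < S.μ (U ∩ S.DG) := by
  haveI := S.haar
  have hpos : 0 < S.μ U := hU.measure_pos S.μ hne
  by_contra h0
  have hz : S.μ (U ∩ S.DG) = 0 := by
    exact nonpos_iff_eq_zero.mp (not_lt.mp h0)
  -- every translate `U ∩ γ • DG` is null
  have hpiece : ∀ γ : S.Gk, S.μ (U ∩ γ • S.DG) = 0 := by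
    intro γ
    have e : U ∩ γ • S.DG = (fun z => (γ : G) * z) '' (U ∩ S.DG) := by
      ext x
      constructor
      · rintro ⟨hxU, w, hw, rfl⟩
        refine ⟨w, ⟨?_, hw⟩, rfl⟩
        simp only [Subgroup.smul_def, smul_eq_mul] at hxU
        exact (hinv γ w).mpr hxU
      · rintro ⟨w, ⟨hwU, hw⟩, rfl⟩
        exact ⟨(hinv γ w).mp hwU, w, hw, by simp only [Subgroup.smul_def, smul_eq_mul]⟩
    rw [e]
    have : (fun z => (γ : G) * z) '' (U ∩ S.DG) = (fun z => (γ : G)⁻¹ * z) ⁻¹' (U ∩ S.DG) := by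
      ext z
      simp only [Set.mem_image, Set.mem_preimage]
      constructor
      · rintro ⟨y, hy, rfl⟩
        simpa using hy
      · intro hz
        exact ⟨(γ : G)⁻¹ * z, hz, by simp⟩
    rw [this, measure_preimage_mul, hz]
  have hU' : S.μ (⋃ γ : S.Gk, U ∩ γ • S.DG) = 0 := measure_iUnion_null hpiece
  have hnull : S.μ {x : G | ¬ ∃ γ : S.Gk, γ • x ∈ S.DG} = 0 := ae_iff.mp S.fdG.ae_covers
  have hsub : U ⊆ (⋃ γ : S.Gk, U ∩ γ • S.DG) ∪ {x : G | ¬ ∃ γ : S.Gk, γ • x ∈ S.DG} := by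
    intro x hx
    by_cases h : ∃ γ : S.Gk, γ • x ∈ S.DG
    · obtain ⟨γ, hγ⟩ := h
      refine Or.inl (Set.mem_iUnion.mpr ⟨γ⁻¹, hx, ?_⟩)
      refine ⟨γ • x, hγ, ?_⟩
      simp only [Subgroup.smul_def, smul_eq_mul, Subgroup.coe_inv, inv_mul_cancel_left]
    · exact Or.inr h
  exact hpos.ne' (measure_mono_null hsub (measure_union_null hU' hnull))

/-- R-A: two continuous `G(k)`-invariant functions that agree a.e. on `DG` agree everywhere. -/
theorem eq_of_ae_eq_DG [Countable S.Gk] {ψ φ : G → ℂ} (hψ : S.Invariant ψ) (hψc : Continuous ψ)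
    (hφ : S.Invariant φ) (hφc : Continuous φ) (h : ψ =ᵐ[S.μ.restrict S.DG] φ) : ψ = φ := by
  by_contra hne
  have hne' : ∃ x, ψ x ≠ φ x := by
    by_contra hall
    exact hne (funext fun x => by by_contra hx; exact hall ⟨x, hx⟩)
  have hU : IsOpen {x : G | ψ x ≠ φ x} := isOpen_ne_fun hψc hφc
  have hinv : ∀ γ : S.Gk, ∀ x, x ∈ {x : G | ψ x ≠ φ x} ↔ (γ : G) * x ∈ {x : G | ψ x ≠ φ x} := by
    intro γ x
    simp only [Set.mem_setOf_eq, hψ γ x, hφ γ x]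
  have hpos := S.measure_inter_DG_pos_of_invariant hU hne' hinv
  have hz : S.μ ({x : G | ψ x ≠ φ x} ∩ S.DG) = 0 := by
    have := ae_iff.mp h
    rw [Measure.restrict_apply₀' S.fdG.nullMeasurableSet] at this
    exact this
  exact hpos.ne' hz

/-- R-A′: a continuous invariant function with `S.inner ψ ψ = 0` vanishes identically. -/
theorem eq_zero_of_inner_self_eq_zero [Countable S.Gk] {ψ : G → ℂ} (hψ : S.Invariant ψ)
    (hψc : Continuous ψ) (h : S.inner ψ ψ = 0) : ψ = 0 := by
  haveI := S.haar
  haveI : IsFiniteMeasure (S.μ.restrict S.DG) := isFiniteMeasure_restrict.mpr S.measure_DG_ne_top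
  -- `S.inner ψ ψ = ∫_{DG} ‖ψ‖²`
  have e : S.inner ψ ψ = ((∫ x in S.DG, ‖ψ x‖ ^ 2 ∂S.μ : ℝ) : ℂ) := by
    unfold inner
    rw [← integral_complex_ofReal]
    congr 1
    ext x
    rw [RCLike.mul_conj]
    norm_cast
  rw [e] at h
  have h' : ∫ x in S.DG, ‖ψ x‖ ^ 2 ∂S.μ = 0 := by exact_mod_cast h
  have hint : Integrable (fun x => ‖ψ x‖ ^ 2) (S.μ.restrict S.DG) := by
    have hc : Continuous fun x => ‖ψ x‖ ^ 2 := by fun_prop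
    exact (hc.continuousOn.integrableOn_compact' S.compG isClosed_closure.measurableSet).mono_set
      subset_closure
  have hae : (fun x => ‖ψ x‖ ^ 2) =ᵐ[S.μ.restrict S.DG] 0 :=
    (integral_eq_zero_iff_of_nonneg (fun x => by positivity) hint).mp h'
  have hae' : ψ =ᵐ[S.μ.restrict S.DG] (0 : G → ℂ) := by
    filter_upwards [hae] with x hx
    simp only [Pi.zero_apply] at hx ⊢
    exact norm_eq_zero.mp (pow_eq_zero_iff (n := 2) (by norm_num) |>.mp hx)
  exact S.eq_of_ae_eq_DG hψ hψc (fun _ _ => rfl) continuous_const hae'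

/-- the right translate `DG · g` of the fundamental domain is a fundamental domain. -/
theorem isFundamentalDomain_mul_right (g : G) :
    IsFundamentalDomain S.Gk ((fun x => x * g) '' S.DG) S.μ := by
  haveI := S.haar
  haveI := S.rightInv
  refine S.fdG.image_of_equiv (Equiv.mulRight g) ?_ (Equiv.refl S.Gk) ?_
  · exact (measurePreserving_mul_right S.μ g⁻¹).quasiMeasurePreserving
  · intro γ x
    simp only [Equiv.coe_mulRight, Equiv.refl_apply, Subgroup.smul_def, smul_eq_mul, mul_assoc]

/-- R-B: right translation is unitary for `S.inner` on continuous invariant functions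
(`∫_{DG} F(x g) dx = ∫_{DG · g} F = ∫_{DG} F` for `G(k)`-invariant `F`). -/
theorem inner_rightTranslate [Countable S.Gk] {ψ φ : G → ℂ} (hψ : S.Invariant ψ)
    (hφ : S.Invariant φ) (g : G) :
    S.inner (fun x => ψ (x * g)) (fun x => φ (x * g)) = S.inner ψ φ := by
  haveI := S.haar
  haveI := S.rightInv
  unfold inner
  set F : G → ℂ := fun x => ψ x * conj (φ x) with hF
  have hFinv : ∀ (γ : S.Gk) (x : G), F (γ • x) = F x := by
    intro γ x
    simp only [hF, Subgroup.smul_def, smul_eq_mul, hψ γ x, hφ γ x]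
  have e1 : ∫ x in S.DG, ψ (x * g) * conj (φ (x * g)) ∂S.μ =
      ∫ y in (fun x => x * g) '' S.DG, F y ∂S.μ := by
    have := (measurePreserving_mul_right S.μ g).setIntegral_preimage_emb
      (measurableEmbedding_mulRight g) F ((fun x => x * g) '' S.DG)
    have hpre : (fun x => x * g) ⁻¹' ((fun x => x * g) '' S.DG) = S.DG :=
      (measurableEmbedding_mulRight g).injective.preimage_image S.DG
    rw [hpre] at this
    exact this
  rw [e1]
  exact (S.isFundamentalDomain_mul_right g).setIntegral_eq S.fdG hFinv

omit [IsTopologicalGroup G] [BorelSpace G] in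
/-- the kernel of the reflected test function is the transposed kernel: `K_{fˇ}(x, w) = K_f(w, x)`. -/
theorem kernel_refl (f : G → ℂ) (x w : G) : S.kernel (refl f) x w = S.kernel f w x := by
  unfold kernel refl
  rw [← (Equiv.inv S.Gk).tsum_eq (fun γ : S.Gk => f (w⁻¹ * γ * x))]
  congr 1
  ext γ
  simp only [Equiv.inv_apply, Subgroup.coe_inv, mul_inv_rev, inv_inv, mul_assoc]

omit [IsTopologicalGroup G] [BorelSpace G] in
/-- the kernel of the conjugate test function is the conjugate kernel. -/
theorem kernel_cj (f : G → ℂ) (x w : G) : S.kernel (cj f) x w = conj (S.kernel f x w) := by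
  unfold kernel cj
  exact (Complex.conj_tsum (fun γ : S.Gk => f (x⁻¹ * γ * w))).symm


omit [IsTopologicalGroup G] [BorelSpace G] in
/-- almost every point of the product of the restricted measures lies in `DG × DG`. -/
theorem ae_prod_mem_DG :
    ∀ᵐ p ∂((S.μ.restrict S.DG).prod (S.μ.restrict S.DG)), p.1 ∈ S.DG ∧ p.2 ∈ S.DG := by
  haveI : IsFiniteMeasure (S.μ.restrict S.DG) := isFiniteMeasure_restrict.mpr S.measure_DG_ne_top
  have h1 : (S.μ.restrict S.DG) S.DGᶜ = 0 := by
    have := ae_restrict_mem₀ (μ := S.μ) S.fdG.nullMeasurableSet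
    rw [ae_iff] at this
    exact this
  rw [ae_iff]
  have hsub : {p : G × G | ¬ (p.1 ∈ S.DG ∧ p.2 ∈ S.DG)} ⊆
      S.DGᶜ ×ˢ (Set.univ : Set G) ∪ (Set.univ : Set G) ×ˢ S.DGᶜ := by
    intro p hp
    simp only [Set.mem_setOf_eq, not_and_or] at hp
    rcases hp with hp | hp
    · exact Or.inl ⟨hp, Set.mem_univ _⟩
    · exact Or.inr ⟨Set.mem_univ _, hp⟩
  refine measure_mono_null hsub (measure_union_null ?_ ?_)
  · rw [Measure.prod_prod, h1, zero_mul]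
  · rw [Measure.prod_prod, h1, mul_zero]

omit [IsTopologicalGroup G] in
/-- a continuous function on `G × G` is integrable for the product of the restricted measures on `DG`
(`G` second countable: the product σ-algebra is the Borel σ-algebra). -/
theorem integrable_prod_DG [SecondCountableTopology G] {F : G × G → ℂ} (hF : Continuous F) :
    Integrable F ((S.μ.restrict S.DG).prod (S.μ.restrict S.DG)) := by
  haveI : IsFiniteMeasure (S.μ.restrict S.DG) := isFiniteMeasure_restrict.mpr S.measure_DG_ne_top
  obtain ⟨C, hC⟩ := (S.compG.prod S.compG).exists_bound_of_continuousOn hF.continuousOn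
  refine Integrable.mono' (integrable_const C) hF.aestronglyMeasurable ?_
  filter_upwards [S.ae_prod_mem_DG] with p hp
  exact hC p ⟨subset_closure hp.1, subset_closure hp.2⟩

/-- R-C: the adjoint identity `⟨R(f)ψ, φ⟩ = ⟨ψ, R(f*)φ⟩`, `f* = conj fˇ`, on continuous invariant functions:
`R(f)` is the kernel operator with kernel `K_f(x, z)`, `R(f*)` the one with kernel `conj K_f(z, x)`; Fubini on
`DG × DG` (`G` second countable). -/
theorem inner_R_eq_inner_R_adj [SecondCountableTopology G] {f : G → ℂ} (hf : IsTest f) {ψ φ : G → ℂ}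
    (hψ : S.Invariant ψ) (hψc : Continuous ψ) (hφ : S.Invariant φ) (hφc : Continuous φ) :
    S.inner (S.R f ψ) φ = S.inner ψ (S.R (cj (refl f)) φ) := by
  haveI := S.haar
  have hf' : IsTest (cj (refl f)) := hf.refl.cj
  -- both sides as double integrals over `DG × DG`
  have e1 : S.inner (S.R f ψ) φ =
      ∫ x in S.DG, ∫ z in S.DG, S.kernel f x z * ψ z * conj (φ x) ∂S.μ ∂S.μ := by
    unfold inner
    apply integral_congr_ae
    filter_upwards with x
    rw [← S.kernelOp_eq_R hf hψ hψc x]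
    unfold kernelOp
    rw [← integral_mul_const]
  have e2 : S.inner ψ (S.R (cj (refl f)) φ) =
      ∫ z in S.DG, ∫ x in S.DG, S.kernel f x z * ψ z * conj (φ x) ∂S.μ ∂S.μ := by
    unfold inner
    apply integral_congr_ae
    filter_upwards with z
    rw [← S.kernelOp_eq_R hf' hφ hφc z]
    unfold kernelOp
    rw [← integral_conj, ← integral_const_mul]
    apply integral_congr_ae
    filter_upwards with x
    rw [S.kernel_cj, S.kernel_refl, map_mul, Complex.conj_conj]
    ring
  rw [e1, e2]
  haveI : IsFiniteMeasure (S.μ.restrict S.DG) := isFiniteMeasure_restrict.mpr S.measure_DG_ne_top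
  -- Fubini
  have hF : Continuous fun p : G × G => S.kernel f p.1 p.2 * ψ p.2 * conj (φ p.1) :=
    ((S.kernel_continuous hf).mul (hψc.comp continuous_snd)).mul
      (Complex.continuous_conj.comp (hφc.comp continuous_fst))
  exact integral_integral_swap (S.integrable_prod_DG hF)

end Setting

end RTF

end Summit.Ventures.HodgeRepro.Tier4.Line1
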